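import Summits.BirchSwinnertonDyer.Rank1Residual.P2.CongruentNumberSilentEvenFiveThetaCMGalois
import HarnessLib
import HarnessLib.Audit.Tags

/-!
# Cell «bsd-monsky» (prover-B): route B's descent core for GENERAL square-free `n ≡ 6 (mod 8)`
# (PROOF-B §8 / the Θ-criterion of the scope note), a kernel theorem relative to TYZ's displayed §3 sentences
# (nothing asserted)

HONEST FRAMING (cell `bsd-monsky`, run/shared/lean/pub/bsd-monsky/; README §1/§3: the cell's CLAIMED theorem is Monsky's
conjecture on the `k = 2` family `𝒮⁻`; «ℓ ≥ 3 rungs are NOT claimed — record what the same argument gives there, no more»).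
This file is that record IN THE KERNEL, part 2: the descent core of PROOF-B §8 for general `n`, i.e. the `k = 2` theorem
`ThetaDescent.odd_scriptL_of_thetaSpec_of_rank` (`P2/…ThetaDescent.lean`) with its three-block recursion assembly replaced
by a HYPOTHESIS `(θ−1)P(n) = G·w + m·τ(1)`:
* `theta_fourTorsion_of_sqrtNeg_two`: (θ2) `(θ−1)A[4] ⊆ ℤτ(i/2)` from `θ(i) = −i`, `θ(√−2) = −√−2` (`√2 := i√−2`; the kernel
  theorem `exists_map_sub_eq_zsmul_of_four_nsmul_eq_zero` of `…ThetaFourTorsion.lean`);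
* `odd_scriptL_of_theta_rec`: TYZ data `D` for square-free `n ≡ 6 (mod 8)` with `scriptLSpec`, `thm35Main`, `lemma318`
  (displayed, `GenusPointDescentDisplays`); rank `E_n(ℚ) ≤ 1` once `𝓛(n) ≠ 0`; `θ` with `θ(√−n) = √−n`, `θ(i) = −i`,
  `θ(√−2) = −√−2`; `(θ−1)P(n) = G·w + m·τ(1)` with `2w ∈ {0, τ(1)}`, `θw + w = τ(1)`, `G` odd ⟹ `𝓛(n)` odd;
* `odd_scriptL_of_theta_rec_of_GZK`: the rank input from Gross–Zagier–Kolyvagin by name.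
Nothing is asserted; no conjecture discharged; no class booked. Consumed by `P2/CongruentNumberThetaThreePrimes.lean`.

References: [TianYuanZhang2017] Thm. 3.5 (p0011 L94–L112), Lemma 3.16–3.18 (p0017), §3.1 (p0011 L67–L73);
HOME/proof/PROOF-B.md v1.3 §8; HOME/proof/PROOF-B-K3-SCOPE.md §3 (prover-B g6).
-/

noncomputable section

open scoped Classical

open WeierstrassCurve WeierstrassCurve.Affine Literature.NumberTheory.EllipticCurves
  Literature.NumberTheory.EllipticCurves.Rank1Residual
  Literature.NumberTheory.EllipticCurves.Rank1Residual.Typed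
  Literature.NumberTheory.EllipticCurves.TianYuanZhang2017
  Literature.NumberTheory.EllipticCurves.TianYuanZhang2017.W2

set_option autoImplicit false

namespace Summit.BirchSwinnertonDyer.Rank1Residual.P2

namespace ThetaDescent

variable {n : ℕ}

/-! ## The descent core for general `n ≡ 6 (mod 8)` -/

/-- **(θ2) from `θ(i) = −i`, `θ(√−2) = −√−2`** (`√2 := i·√−2`, `…ThetaFourTorsion`): `(θ−1)t ∈ ℤτ(i/2)` for every `t`
with `4t = 0`. [cite: TianYuanZhang2017, Lemma 3.16–3.17 (p0017 L98–L149)] -/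
theorem theta_fourTorsion_of_sqrtNeg_two (D : GenusPointData n) (h2 : 2 ∈ n.divisors) (θ : D.H ≃ₐ[ℚ] D.H)
    (hθi : θ D.im = -D.im) (hθ2 : θ (D.sqrtNeg 2) = -D.sqrtNeg 2) :
    ∀ t : APoint D.H, (4 : ℕ) • t = 0 → ∃ k : ℤ, thetaPt D θ t - t = k • D.tauIHalf := by
  have hsq2 : D.sqrtNeg 2 ^ 2 = -((2 : ℕ) : D.H) := D.sqrtNeg_sq 2 h2
  have hs : (D.im * D.sqrtNeg 2) ^ 2 = 2 := by
    rw [mul_pow, D.im_sq, hsq2]; push_cast; ring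
  have hθi' : θ.toAlgHom D.im = -D.im := hθi
  have hθs : θ.toAlgHom (D.im * D.sqrtNeg 2) = D.im * D.sqrtNeg 2 := by
    show θ (D.im * D.sqrtNeg 2) = D.im * D.sqrtNeg 2
    rw [map_mul, hθi, hθ2]; ring
  intro t ht
  exact exists_map_sub_eq_zsmul_of_four_nsmul_eq_zero θ.toAlgHom D.im (D.im * D.sqrtNeg 2) D.im_sq hs hθi' hθs t ht

/-- **THE DESCENT CORE for general square-free `n ≡ 6 (mod 8)`** (PROOF-B §8 / the Θ-criterion of PROOF-B-K3-SCOPE §3): TYZ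
data `D` with `scriptLSpec`, `thm35Main`, `lemma318`; rank `E_n(ℚ) ≤ 1` once `𝓛(n) ≠ 0` (`hr`); an automorphism `θ` with
`θ(√−n) = √−n`, `θ(i) = −i`, `θ(√−2) = −√−2`; and a recursion-side identity `(θ−1)P(n) = G·w + m·τ(1)` with `2w ∈ {0, τ(1)}`,
`θw + w = τ(1)` and `G` ODD. Then `𝓛(n)` (the data's sign choice) is ODD. Proof = `odd_scriptL_of_thetaSpec_of_rank`
verbatim: if `𝓛(n) = 2m`, the `E`-side relation (Thm. 3.5 with a `θ`-fixed `R′`) and Lemma 3.18 put `(θ−1)P(n)` in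
`ℤτ(1) + (θ−1)A[4] ⊆ ℤτ(i/2)`, whence `w ∈ ℤτ(i/2)` and `θw + w = 0 ≠ τ(1)`.
[cite: TianYuanZhang2017, Thm. 3.5 (p0011 L94–L112), Lemma 3.18 (p0017 L152–L153), §3.1 (p0011 L67–L73)] -/
theorem odd_scriptL_of_theta_rec (hsq : Squarefree n) (h6 : n % 8 = 6) (D : GenusPointData n)
    (hLspec : D.scriptLSpec) (h35 : D.thm35Main) (h318 : D.lemma318)
    (hr :
      letI := isElliptic_congruentNumberCurve hsq.ne_zero
      D.scriptL n ≠ 0 → (congruentNumberCurve n).mordellWeilRank ≤ 1)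
    (θ : D.H ≃ₐ[ℚ] D.H) (hθK : θ (D.sqrtNeg n) = D.sqrtNeg n) (hθi : θ D.im = -D.im)
    (hθ2 : θ (D.sqrtNeg 2) = -D.sqrtNeg 2)
    {w : APoint D.H} {G m' : ℤ} (hw2 : (2 : ℕ) • w = 0 ∨ (2 : ℕ) • w = tauOne)
    (hww : thetaPt D θ w + w = tauOne)
    (hrecθ : thetaPt D θ (D.P n) - D.P n = G • w + m' • tauOne) (hG : Odd G) :
    Odd (D.scriptL n) := by
  have hn0 : n ≠ 0 := hsq.ne_zero
  have hn : n ∈ n.divisors := Nat.mem_divisors_self _ hn0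
  have h2n : 2 ∈ n.divisors := Nat.mem_divisors.mpr ⟨by omega, hn0⟩
  have hA4 := theta_fourTorsion_of_sqrtNeg_two D h2n θ hθi hθ2
  by_contra hodd
  obtain ⟨m, hm⟩ := Int.not_odd_iff_even.mp hodd
  -- the `E`-side relation with a `θ`-fixed `R′`
  obtain ⟨R', Q₁, ε', hR'fix, hQ₁, hF1E⟩ :=
    exists_theta_fixed_rep hsq (Or.inr (Or.inl h6)) hn D hr hLspec h35 θ hθK
  -- `θ − 1` on `A` and on `A₂`
  set DA : APoint D.H →+ APoint D.H := thetaPt D θ - AddMonoidHom.id _ with hDA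
  set DE : A2Point D.H →+ A2Point D.H := thetaPtE D θ - AddMonoidHom.id _ with hDE
  have hDA_apply : ∀ x, DA x = thetaPt D θ x - x := fun x => rfl
  have hcomm : ∀ x, φH D (DA x) = DE (φH D x) := by
    intro x
    rw [hDA_apply, map_sub, φH_thetaPt]; rfl
  have hDER : DE R' = 0 := by
    show thetaPtE D θ R' - R' = 0
    rw [hR'fix, sub_self]
  have h2 : (2 : ℕ) • (tauOne : APoint D.H) = 0 := two_nsmul_tauOne
  have hker : ∀ x, φH D x = 0 → x = 0 ∨ x = tauOne := fun x hx => (φH_eq_zero_iff D x).mp hx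
  obtain ⟨t', ht', hDAQ₁, hDAP⟩ :=
    W2.Abstract.exists_decomp_NA (φH D) h2 hker DA DE hcomm hDER hQ₁ (m := m) (by rw [hm]; ring) hF1E
  -- `(θ−1)t′ ∈ ℤτ(i/2)` and `(θ−1)Q₁ ∈ ℤτ(1) = 2ℤτ(i/2)`
  have h4t' : (4 : ℕ) • t' = 0 := ((h318.2 (Nat.even_iff.mpr (by omega))).1 t' ht')
  obtain ⟨k₁, hk₁⟩ := hA4 t' h4t'
  have h2τ : (2 : ℤ) • D.tauIHalf = (tauOne : APoint D.H) := by
    rw [two_zsmul, ← two_nsmul]; exact (tau_facts D).2.2.1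
  have hDAQ₁' : ∃ k₂ : ℤ, DA Q₁ = k₂ • D.tauIHalf := by
    rcases (W2.Abstract.mem_zmultiples_iff_of_two_nsmul_eq_zero h2).mp hDAQ₁ with h0 | h0
    · exact ⟨0, by rw [h0, zero_smul]⟩
    · exact ⟨2, by rw [h0, h2τ]⟩
  obtain ⟨k₂, hk₂⟩ := hDAQ₁'
  have hDAP' : DA (D.P n) = (ε' * m * k₂ + k₁) • D.tauIHalf := by
    rw [hDAP, hk₂, hDA_apply t', hk₁, smul_smul, add_smul]
  -- the recursion side
  rw [hDA_apply] at hDAP'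
  rw [hDAP'] at hrecθ
  -- `w ∈ ℤτ(i/2)`
  obtain ⟨r, hr'⟩ := hG
  have hw : ∃ K : ℤ, w = K • D.tauIHalf := by
    have h2w : ∃ j : ℤ, (2 : ℕ) • w = j • D.tauIHalf := by
      rcases hw2 with h0 | h0
      · exact ⟨0, by rw [h0, zero_smul]⟩
      · exact ⟨2, by rw [h0, h2τ]⟩
    obtain ⟨j, hj⟩ := h2w
    refine ⟨ε' * m * k₂ + k₁ - m' * 2 - r * j, ?_⟩
    have e3 : G • w = (ε' * m * k₂ + k₁) • D.tauIHalf - m' • tauOne := eq_sub_of_add_eq hrecθ.symm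
    have e4 : w = G • w - r • ((2 : ℕ) • w) := by
      rw [hr']; module
    calc w = G • w - r • ((2 : ℕ) • w) := e4
      _ = ((ε' * m * k₂ + k₁) • D.tauIHalf - m' • tauOne) - r • (j • D.tauIHalf) := by rw [e3, hj]
      _ = ((ε' * m * k₂ + k₁) • D.tauIHalf - m' • ((2 : ℤ) • D.tauIHalf)) - r • (j • D.tauIHalf) := by rw [h2τ]
      _ = (ε' * m * k₂ + k₁ - m' * 2 - r * j) • D.tauIHalf := by module
  obtain ⟨K, hK⟩ := hw
  -- `θw + w = 0`, contradiction with `θw + w = τ(1) ≠ 0`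
  have h0 : thetaPt D θ w + w = 0 := by
    rw [hK, map_zsmul, thetaPt_tauIHalf D θ hθi, smul_neg, neg_add_cancel]
  rw [h0] at hww
  exact tauOne_ne_zero hww.symm

/-- **The core with the rank input from GZK** (`𝓛(n) ≠ 0` ⟹ `ord_{s=1} L(E_n, s) = 1` ⟹ rank `1`).
[cite: TianYuanZhang2017, Thm. 3.5 (p0011 L94–L112)] -/
theorem odd_scriptL_of_theta_rec_of_GZK (hsq : Squarefree n) (h6 : n % 8 = 6)
    (hGZK : rank_eq_analyticRank_of_analyticRank_le_one) (D : GenusPointData n)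
    (hLspec : D.scriptLSpec) (h35 : D.thm35Main) (h318 : D.lemma318)
    (θ : D.H ≃ₐ[ℚ] D.H) (hθK : θ (D.sqrtNeg n) = D.sqrtNeg n) (hθi : θ D.im = -D.im)
    (hθ2 : θ (D.sqrtNeg 2) = -D.sqrtNeg 2)
    {w : APoint D.H} {G m' : ℤ} (hw2 : (2 : ℕ) • w = 0 ∨ (2 : ℕ) • w = tauOne)
    (hww : thetaPt D θ w + w = tauOne)
    (hrecθ : thetaPt D θ (D.P n) - D.P n = G • w + m' • tauOne) (hG : Odd G) :
    Odd (D.scriptL n) := by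
  haveI := isElliptic_congruentNumberCurve hsq.ne_zero
  have hn1 : 1 < n := by omega
  refine odd_scriptL_of_theta_rec hsq h6 D hLspec h35 h318 (fun hL0 => ?_) θ hθK hθi hθ2 hw2 hww hrecθ hG
  have hL : IsScriptL n (D.scriptL n) := hLspec _ (Nat.mem_divisors_self _ hsq.ne_zero) hn1
  have har := S4 hsq (Or.inr (Or.inl h6)) hL hL0
  rw [(hGZK (congruentNumberCurve n) har).1]; exact har

end ThetaDescent

end Summit.BirchSwinnertonDyer.Rank1Residual.P2

end
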